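import Summits.AnomalousDissipation.AnomalousDissipation.Theorems.SawtoothPulseCascadeK1LocalisedCascadeChordPhase

/-!
# K1loc, line `Spectral` — S-D (first good piece): REFINEMENT AND CHORD SUM WITH SMALLNESS ONLY AT THE PHASES `j < n`

Helper file of the prover lane on the crux `K1LocalisedCascade` (stmt-AnomalousDissipation-19491), route
`SawtoothPulseCascade`, registered line `Cruxes.K1LocalisedCascade.Spectral` (one open stub `stub_highModeConcentration`).
`…LineRefineCascade.lineRefine_cascade` and `…ChordPhase.chord_sum_le` asked the zone inequalities `M₂δ_j/(2πN_j) + E ≤ M₁δ_j/(2πN_j)` for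
EVERY `j : ℕ`, which forces `E = 0` (`δ_j → 0`); only the phases `j < n` are ever used.  This file re-derives both with the hypotheses
restricted to `j < n` (`lineRefine_cascade_lt`: the abstract `…LineRefine.lineRefine` instantiated with the corner half-width
`ζ₁ j = M₁δ_j/(2πN_j)` for `j < n` and a vacuous large value beyond; `chord_sum_le_lt`).
[cite: ElgindiLissMattingly2025, §1.2.2, §3.1] [problem: turb]
-/

-- `Summit.<Summit>.<Problem>`: single-conjunct summit, the duplicate namespace segment is deliberate.
set_option linter.dupNamespace false

noncomputable section

namespace Summit.AnomalousDissipation.AnomalousDissipation.Theorems.SawtoothPulseCascade.K1Start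

open Set Matrix Function MeasureTheory Complex UnitAddTorus intervalIntegral
open scoped ENNReal
open Literature.Analysis Literature.Analysis.FunctionSpaces Literature.Analysis.FunctionSpaces.Torus
open Literature.Analysis.FluidPDE.ShearStage
open Literature.Analysis.FluidPDE.SawtoothCascade Literature.Analysis.FluidPDE.SawtoothCascade.CascadeParams

section Cascade

variable (P : CascadeParams)

/-- The line refinement with the corner half-width `ζ₁ j = M₁δ_j/(2πN_j)` for `j < n` and a vacuous large value beyond
(instantiation of `…LineRefine.lineRefine`; intermediate form). [cite: ElgindiLissMattingly2025, §1.2.2, §3.1] -/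
theorem lineRefine_cascade_if (hγ : 1 ≤ P.γ) (h8 : 8 ≤ P.γ ^ 2) (hδ₀ : 0 < P.δ₀) (hd : 0 < P.d) (hN₀ : 1 ≤ P.N₀) (hρ : 1 ≤ P.ρN)
    {M₁ M₂ : ℝ} (hM₁ : 0 < M₁) (hM : 1 ≤ M₂) (hMδ : ∀ j, M₂ * P.δ j < Real.pi / 2) {n : ℕ} (Y : EuclideanSpace ℝ (Fin 2))
    (z : ℝ → ℕ → EuclideanSpace ℝ (Fin 2)) (hzn : ∀ s, z s n = Y + s • EuclideanSpace.single 0 1)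
    (hz : ∀ s, ∀ j < n, z s j = shearMapLift 0 1 (amp ⟨P.U j, P.U_periodic j, P.contDiff_U (P.δ_pos hδ₀ hd j)⟩ P.γ)
      (shearMapLift 1 0 (amp ⟨P.U j, P.U_periodic j, P.contDiff_U (P.δ_pos hδ₀ hd j)⟩ P.γ) (z s (j + 1))))
    {EV EH : ℝ} (B : ℕ → ℝ)
    (hEV : ∀ ℓ, ℓ < n → (∑ i ∈ Finset.range ℓ, (1 + P.γ + P.γ ^ 2) ^ i *
        ((P.γ ^ 2 * (1 / (2 * P.N (n - ℓ + i)) - M₂ * P.δ (n - ℓ + i) / (Real.pi * P.N (n - ℓ + i))) +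
          P.γ * (1 / (2 * P.N (n - ℓ + i)) - M₂ * P.δ (n - ℓ + i) / (Real.pi * P.N (n - ℓ + i)))) *
          (2 * Real.exp (-(M₂ ^ 2 / 2))))) ≤ EV)
    (hEH : (1 + P.γ) * EV + P.γ * (2 * Real.exp (-(M₂ ^ 2 / 2))) * ((1 + P.γ + P.γ ^ 2) ^ n + EV) ≤ EH)
    (hζV : ∀ j, j < n → M₂ * P.δ j / (2 * Real.pi * P.N j) + EV ≤ M₁ * P.δ j / (2 * Real.pi * P.N j))
    (hζH : ∀ j, j < n → M₂ * P.δ j / (2 * Real.pi * P.N j) + EH ≤ M₁ * P.δ j / (2 * Real.pi * P.N j))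
    (hB0 : ((P.γ ^ 2 - 3) ^ n)⁻¹ ≤ B 0)
    (hB : ∀ ℓ, ℓ < n → 4 * B ℓ + 2 * P.N (n - ℓ - 1) * (P.γ + 2 + 2 / P.γ) / (P.γ ^ 2 - 3) ^ (n - ℓ) ≤ B (ℓ + 1)) :
    ∃ (ι : Type) (S : Finset ι) (u v : ι → ℝ) (pV pH : ι → ℕ → ℤ),
      (∀ i ∈ S, u i ≤ v i ∧ Icc (u i) (v i) ⊆ Icc (0 : ℝ) 1) ∧
      (∀ i ∈ S, ∀ i' ∈ S, i ≠ i' → Disjoint (Icc (u i) (v i)) (Icc (u i') (v i'))) ∧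
      (∑ i ∈ S, (v i - u i) ≤ 1) ∧
      (∀ i ∈ S, ∀ s ∈ Icc (u i) (v i), ∀ j', n - n ≤ j' → j' < n →
        (z s (j' + 1)) 0 ∈ Icc ((((pV i j' : ℤ) : ℝ) / 2 - 1 / 4) / P.N j' + M₂ * P.δ j' / (2 * Real.pi * P.N j'))
          ((((pV i j' : ℤ) : ℝ) / 2 + 1 / 4) / P.N j' - M₂ * P.δ j' / (2 * Real.pi * P.N j')) ∧
        ((z s (j' + 1)) 1 - P.γ * P.U j' ((z s (j' + 1)) 0)) ∈
          Icc ((((pH i j' : ℤ) : ℝ) / 2 - 1 / 4) / P.N j' + M₂ * P.δ j' / (2 * Real.pi * P.N j'))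
          ((((pH i j' : ℤ) : ℝ) / 2 + 1 / 4) / P.N j' - M₂ * P.δ j' / (2 * Real.pi * P.N j'))) ∧
      (∑ i ∈ S, ((P.γ ^ 2 - 3) ^ (n - n) * |itinJac P.γ ((List.range n).map fun k =>
            (-(1 - 2 * ((pH i (n - n + k) % 2 : ℤ) : ℝ)), -(1 - 2 * ((pV i (n - n + k) % 2 : ℤ) : ℝ)))) 0 0|)⁻¹ ≤ B n) ∧
      (∀ s ∈ Icc (0 : ℝ) 1, (∃ i ∈ S, s ∈ Icc (u i) (v i)) ∨
        ∃ j', n - n ≤ j' ∧ j' < n ∧ ∃ m : ℤ,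
          |(z s (j' + 1)) 0 - ((m : ℝ) / 2 + 1 / 4) / P.N j'| < (if j' < n then M₁ * P.δ j' / (2 * Real.pi * P.N j') else M₂ * P.δ j' / (2 * Real.pi * P.N j') + |EV| + |EH| + 1) + EV ∨
          |((z s (j' + 1)) 1 - P.γ * P.U j' ((z s (j' + 1)) 0)) - ((m : ℝ) / 2 + 1 / 4) / P.N j'| <
            (if j' < n then M₁ * P.δ j' / (2 * Real.pi * P.N j') else M₂ * P.δ j' / (2 * Real.pi * P.N j') + |EV| + |EH| + 1) + EH) := by
  have hγ0 : 0 < P.γ := by linarith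
  have hN : ∀ j, 0 < P.N j := P.N_pos hN₀ hρ
  have hζpos : ∀ j, 0 < M₁ * P.δ j / (2 * Real.pi * P.N j) := fun j => by
    have := P.δ_pos hδ₀ hd j
    have := hN j
    positivity
  have hζ2pos : ∀ j, 0 < M₂ * P.δ j / (2 * Real.pi * P.N j) := fun j => by
    have := P.δ_pos hδ₀ hd j
    have := hN j
    positivity
  have hζ₁ : ∀ j, 0 < (if j < n then M₁ * P.δ j / (2 * Real.pi * P.N j) else M₂ * P.δ j / (2 * Real.pi * P.N j) + |EV| + |EH| + 1) := fun j => by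
    split_ifs
    · exact hζpos j
    · have := hζ2pos j; positivity
  have hζV' : ∀ j, M₂ * P.δ j / (2 * Real.pi * P.N j) + EV ≤ (if j < n then M₁ * P.δ j / (2 * Real.pi * P.N j) else M₂ * P.δ j / (2 * Real.pi * P.N j) + |EV| + |EH| + 1) := fun j => by
    split_ifs with h
    · exact hζV j h
    · linarith [le_abs_self EV, abs_nonneg EH]
  have hζH' : ∀ j, M₂ * P.δ j / (2 * Real.pi * P.N j) + EH ≤ (if j < n then M₁ * P.δ j / (2 * Real.pi * P.N j) else M₂ * P.δ j / (2 * Real.pi * P.N j) + |EV| + |EH| + 1) := fun j => by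
    split_ifs with h
    · exact hζH j h
    · linarith [le_abs_self EH, abs_nonneg EV]
  refine lineRefine P.N (fun j => (if j < n then M₁ * P.δ j / (2 * Real.pi * P.N j) else M₂ * P.δ j / (2 * Real.pi * P.N j) + |EV| + |EH| + 1)) (fun j => M₂ * P.δ j / (2 * Real.pi * P.N j))
    (fun j' s => (z s (j' + 1)) 0) (fun j' s => (z s (j' + 1)) 1 - P.γ * P.U j' ((z s (j' + 1)) 0)) B
    hγ0 h8 hN hζ₁ hζV' hζH' hB0 hB ?_ n le_rfl
  intro ℓ hℓ u v pV pH huv hsub hgood'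
  dsimp only at hgood' ⊢
  have e1 : n - ℓ - 1 + 1 = n - ℓ := by omega
  have e2 : n - (n - ℓ) = ℓ := by omega
  have hpa := piece_affine P hγ hδ₀ hd hN₀ hρ hM hMδ (n := n) (j := n - ℓ - 1) (by omega) Y z hzn hz (u := u) (v := v)
    pV pH (fun s hs j' hj1 hj2 => hgood' s hs j' (by omega) hj2)
    (J := itinJac P.γ ((List.range ℓ).map fun k =>
            (-(1 - 2 * ((pH (n - ℓ + k) % 2 : ℤ) : ℝ)), -(1 - 2 * ((pV (n - ℓ + k) % 2 : ℤ) : ℝ))))) (by rw [e1, e2])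
    (Err := (∑ i ∈ Finset.range ℓ, (1 + P.γ + P.γ ^ 2) ^ i *
        ((P.γ ^ 2 * (1 / (2 * P.N (n - ℓ + i)) - M₂ * P.δ (n - ℓ + i) / (Real.pi * P.N (n - ℓ + i))) +
          P.γ * (1 / (2 * P.N (n - ℓ + i)) - M₂ * P.δ (n - ℓ + i) / (Real.pi * P.N (n - ℓ + i)))) *
          (2 * Real.exp (-(M₂ ^ 2 / 2)))))) (by rw [e1, e2])
  obtain ⟨hV, hH⟩ := hpa
  have hvu1 : v - u ≤ 1 := by
    have h0 := hsub (left_mem_Icc.mpr huv)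
    have h1 := hsub (right_mem_Icc.mpr huv)
    linarith [h0.1, h1.2]
  have hERR := hEV ℓ hℓ
  have hsl := isSignList_pieceItin pV pH (n - ℓ) ℓ
  have hJ : |itinJac P.γ ((List.range ℓ).map fun k =>
            (-(1 - 2 * ((pH (n - ℓ + k) % 2 : ℤ) : ℝ)), -(1 - 2 * ((pV (n - ℓ + k) % 2 : ℤ) : ℝ)))) 0 0| ≤ (1 + P.γ + P.γ ^ 2) ^ n := by
    refine (abs_itinJac_entry_le hγ0.le hsl.1).trans ?_
    rw [hsl.2]
    exact pow_le_pow_right₀ (by nlinarith) hℓ.le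
  refine ⟨fun s hs s' hs' => (hV s hs s' hs').trans hERR,
    fun p a b hab hmem s hs s' hs' => (hH p a b hab hmem s hs s' hs').trans ?_⟩
  have hE0 : 0 ≤ (∑ i ∈ Finset.range ℓ, (1 + P.γ + P.γ ^ 2) ^ i *
        ((P.γ ^ 2 * (1 / (2 * P.N (n - ℓ + i)) - M₂ * P.δ (n - ℓ + i) / (Real.pi * P.N (n - ℓ + i))) +
          P.γ * (1 / (2 * P.N (n - ℓ + i)) - M₂ * P.δ (n - ℓ + i) / (Real.pi * P.N (n - ℓ + i)))) *
          (2 * Real.exp (-(M₂ ^ 2 / 2))))) :=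
    (abs_nonneg _).trans (hV u (left_mem_Icc.mpr huv) u (left_mem_Icc.mpr huv))
  have h1 : |itinJac P.γ ((List.range ℓ).map fun k =>
            (-(1 - 2 * ((pH (n - ℓ + k) % 2 : ℤ) : ℝ)), -(1 - 2 * ((pV (n - ℓ + k) % 2 : ℤ) : ℝ)))) 0 0| * (v - u) ≤ (1 + P.γ + P.γ ^ 2) ^ n :=
    (mul_le_mul_of_nonneg_left hvu1 (abs_nonneg _)).trans (by rw [mul_one]; exact hJ)
  refine le_trans ?_ hEH
  gcongr

/-- **The line refinement on the cascade chord, smallness only at the phases `j < n`.** Same conclusion as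
`…LineRefineCascade.lineRefine_cascade`. [cite: ElgindiLissMattingly2025, §1.2.2, §3.1] -/
theorem lineRefine_cascade_lt (hγ : 1 ≤ P.γ) (h8 : 8 ≤ P.γ ^ 2) (hδ₀ : 0 < P.δ₀) (hd : 0 < P.d) (hN₀ : 1 ≤ P.N₀) (hρ : 1 ≤ P.ρN)
    {M₁ M₂ : ℝ} (hM₁ : 0 < M₁) (hM : 1 ≤ M₂) (hMδ : ∀ j, M₂ * P.δ j < Real.pi / 2) {n : ℕ} (Y : EuclideanSpace ℝ (Fin 2))
    (z : ℝ → ℕ → EuclideanSpace ℝ (Fin 2)) (hzn : ∀ s, z s n = Y + s • EuclideanSpace.single 0 1)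
    (hz : ∀ s, ∀ j < n, z s j = shearMapLift 0 1 (amp ⟨P.U j, P.U_periodic j, P.contDiff_U (P.δ_pos hδ₀ hd j)⟩ P.γ)
      (shearMapLift 1 0 (amp ⟨P.U j, P.U_periodic j, P.contDiff_U (P.δ_pos hδ₀ hd j)⟩ P.γ) (z s (j + 1))))
    {EV EH : ℝ} (B : ℕ → ℝ)
    (hEV : ∀ ℓ, ℓ < n → (∑ i ∈ Finset.range ℓ, (1 + P.γ + P.γ ^ 2) ^ i *
        ((P.γ ^ 2 * (1 / (2 * P.N (n - ℓ + i)) - M₂ * P.δ (n - ℓ + i) / (Real.pi * P.N (n - ℓ + i))) +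
          P.γ * (1 / (2 * P.N (n - ℓ + i)) - M₂ * P.δ (n - ℓ + i) / (Real.pi * P.N (n - ℓ + i)))) *
          (2 * Real.exp (-(M₂ ^ 2 / 2))))) ≤ EV)
    (hEH : (1 + P.γ) * EV + P.γ * (2 * Real.exp (-(M₂ ^ 2 / 2))) * ((1 + P.γ + P.γ ^ 2) ^ n + EV) ≤ EH)
    (hζV : ∀ j, j < n → M₂ * P.δ j / (2 * Real.pi * P.N j) + EV ≤ M₁ * P.δ j / (2 * Real.pi * P.N j))
    (hζH : ∀ j, j < n → M₂ * P.δ j / (2 * Real.pi * P.N j) + EH ≤ M₁ * P.δ j / (2 * Real.pi * P.N j))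
    (hB0 : ((P.γ ^ 2 - 3) ^ n)⁻¹ ≤ B 0)
    (hB : ∀ ℓ, ℓ < n → 4 * B ℓ + 2 * P.N (n - ℓ - 1) * (P.γ + 2 + 2 / P.γ) / (P.γ ^ 2 - 3) ^ (n - ℓ) ≤ B (ℓ + 1)) :
    ∃ (ι : Type) (S : Finset ι) (u v : ι → ℝ) (pV pH : ι → ℕ → ℤ),
      (∀ i ∈ S, u i ≤ v i ∧ Icc (u i) (v i) ⊆ Icc (0 : ℝ) 1) ∧
      (∀ i ∈ S, ∀ i' ∈ S, i ≠ i' → Disjoint (Icc (u i) (v i)) (Icc (u i') (v i'))) ∧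
      (∑ i ∈ S, (v i - u i) ≤ 1) ∧
      (∀ i ∈ S, ∀ s ∈ Icc (u i) (v i), ∀ j', n - n ≤ j' → j' < n →
        (z s (j' + 1)) 0 ∈ Icc ((((pV i j' : ℤ) : ℝ) / 2 - 1 / 4) / P.N j' + M₂ * P.δ j' / (2 * Real.pi * P.N j'))
          ((((pV i j' : ℤ) : ℝ) / 2 + 1 / 4) / P.N j' - M₂ * P.δ j' / (2 * Real.pi * P.N j')) ∧
        ((z s (j' + 1)) 1 - P.γ * P.U j' ((z s (j' + 1)) 0)) ∈
          Icc ((((pH i j' : ℤ) : ℝ) / 2 - 1 / 4) / P.N j' + M₂ * P.δ j' / (2 * Real.pi * P.N j'))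
          ((((pH i j' : ℤ) : ℝ) / 2 + 1 / 4) / P.N j' - M₂ * P.δ j' / (2 * Real.pi * P.N j'))) ∧
      (∑ i ∈ S, ((P.γ ^ 2 - 3) ^ (n - n) * |itinJac P.γ ((List.range n).map fun k =>
            (-(1 - 2 * ((pH i (n - n + k) % 2 : ℤ) : ℝ)), -(1 - 2 * ((pV i (n - n + k) % 2 : ℤ) : ℝ)))) 0 0|)⁻¹ ≤ B n) ∧
      (∀ s ∈ Icc (0 : ℝ) 1, (∃ i ∈ S, s ∈ Icc (u i) (v i)) ∨
        ∃ j', n - n ≤ j' ∧ j' < n ∧ ∃ m : ℤ,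
          |(z s (j' + 1)) 0 - ((m : ℝ) / 2 + 1 / 4) / P.N j'| < M₁ * P.δ j' / (2 * Real.pi * P.N j') + EV ∨
          |((z s (j' + 1)) 1 - P.γ * P.U j' ((z s (j' + 1)) 0)) - ((m : ℝ) / 2 + 1 / 4) / P.N j'| <
            M₁ * P.δ j' / (2 * Real.pi * P.N j') + EH) := by
  obtain ⟨ι, S, u, v, pV, pH, hpiece, hdisj, hlen, hgood, hpot, hcover⟩ :=
    lineRefine_cascade_if P hγ h8 hδ₀ hd hN₀ hρ hM₁ hM hMδ Y z hzn hz B hEV hEH hζV hζH hB0 hB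
  refine ⟨ι, S, u, v, pV, pH, hpiece, hdisj, hlen, hgood, hpot, fun s hs => ?_⟩
  rcases hcover s hs with h | ⟨j', hj'1, hj'2, m, hm⟩
  · exact Or.inl h
  · refine Or.inr ⟨j', hj'1, hj'2, m, ?_⟩
    simpa only [if_pos hj'2] using hm

/-- **The chord exponential sum, smallness only at the phases `j < n`.** Same conclusion as `…ChordPhase.chord_sum_le`.
[cite: ElgindiLissMattingly2025, §1.2.2, §3.1] -/
theorem chord_sum_le_lt (hγ : 1 ≤ P.γ) (h8 : 8 ≤ P.γ ^ 2) (hδ₀ : 0 < P.δ₀) (hd : 0 < P.d) (hN₀ : 1 ≤ P.N₀) (hρ : 1 ≤ P.ρN)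
    {M₁ M₂ : ℝ} (hM₁ : 0 < M₁) (hM : 1 ≤ M₂) (hMδ : ∀ j, M₂ * P.δ j < Real.pi / 2) {n : ℕ} (Y : EuclideanSpace ℝ (Fin 2))
    (z : ℝ → ℕ → EuclideanSpace ℝ (Fin 2)) (hzn : ∀ s, z s n = Y + s • EuclideanSpace.single 0 1)
    (hz : ∀ s, ∀ j < n, z s j = shearMapLift 0 1 (amp ⟨P.U j, P.U_periodic j, P.contDiff_U (P.δ_pos hδ₀ hd j)⟩ P.γ)
      (shearMapLift 1 0 (amp ⟨P.U j, P.U_periodic j, P.contDiff_U (P.δ_pos hδ₀ hd j)⟩ P.γ) (z s (j + 1))))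
    {EV EH : ℝ} (B : ℕ → ℝ) (hEV0 : 0 ≤ EV)
    (hEV : ∀ ℓ, ℓ ≤ n → (∑ i ∈ Finset.range ℓ, (1 + P.γ + P.γ ^ 2) ^ i *
        ((P.γ ^ 2 * (1 / (2 * P.N (n - ℓ + i)) - M₂ * P.δ (n - ℓ + i) / (Real.pi * P.N (n - ℓ + i))) +
          P.γ * (1 / (2 * P.N (n - ℓ + i)) - M₂ * P.δ (n - ℓ + i) / (Real.pi * P.N (n - ℓ + i)))) *
          (2 * Real.exp (-(M₂ ^ 2 / 2))))) ≤ EV)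
    (hEH : (1 + P.γ) * EV + P.γ * (2 * Real.exp (-(M₂ ^ 2 / 2))) * ((1 + P.γ + P.γ ^ 2) ^ n + EV) ≤ EH)
    (hζV : ∀ j, j < n → M₂ * P.δ j / (2 * Real.pi * P.N j) + EV ≤ M₁ * P.δ j / (2 * Real.pi * P.N j))
    (hζH : ∀ j, j < n → M₂ * P.δ j / (2 * Real.pi * P.N j) + EH ≤ M₁ * P.δ j / (2 * Real.pi * P.N j))
    (hB0 : ((P.γ ^ 2 - 3) ^ n)⁻¹ ≤ B 0)
    (hB : ∀ ℓ, ℓ < n → 4 * B ℓ + 2 * P.N (n - ℓ - 1) * (P.γ + 2 + 2 / P.γ) / (P.γ ^ 2 - 3) ^ (n - ℓ) ≤ B (ℓ + 1))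
    {m : ℝ} (hm : |m| < (P.γ ^ 2 - 3) ^ n) :
    ‖∫ s in (0 : ℝ)..1, (Real.sin (2 * Real.pi * (z s 0) 0) : ℂ) * exp (-(2 * Real.pi * I * (m * s)))‖ ≤
      B n / (Real.pi * (1 - |m| / (P.γ ^ 2 - 3) ^ n)) + 2 * Real.pi * EV +
        (volume ({s : ℝ | ∃ j', j' < n ∧ ∃ q : ℤ,
          |(z s (j' + 1)) 0 - ((q : ℝ) / 2 + 1 / 4) / P.N j'| < M₁ * P.δ j' / (2 * Real.pi * P.N j') + EV ∨
          |((z s (j' + 1)) 1 - P.γ * P.U j' ((z s (j' + 1)) 0)) - ((q : ℝ) / 2 + 1 / 4) / P.N j'| <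
            M₁ * P.δ j' / (2 * Real.pi * P.N j') + EH} ∩ Icc (0 : ℝ) 1)).toReal := by
  have hγ0 : 0 < P.γ := by linarith
  obtain ⟨ι, S, u, v, pV, pH, hpiece, hdisj, hlen, hgood, hpot, hcover⟩ :=
    lineRefine_cascade_lt P hγ h8 hδ₀ hd hN₀ hρ hM₁ hM hMδ Y z hzn hz B (fun ℓ hℓ => hEV ℓ hℓ.le) hEH hζV hζH hB0 hB
  have hφ : Continuous fun s => (z s 0) 0 :=
    (EuclideanSpace.proj (0 : Fin 2)).continuous.comp (continuous_traj P hδ₀ hd Y z hzn hz (Nat.zero_le n))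
  have hEVn := hEV n le_rfl
  simp only [Nat.sub_self, zero_add, pow_zero, one_mul] at hgood hpot hcover hEVn
  have hsl : ∀ i, IsSignList ((List.range n).map fun k =>
      (-(1 - 2 * ((pH i k % 2 : ℤ) : ℝ)), -(1 - 2 * ((pV i k % 2 : ℤ) : ℝ)))) ∧
      ((List.range n).map fun k => (-(1 - 2 * ((pH i k % 2 : ℤ) : ℝ)), -(1 - 2 * ((pV i k % 2 : ℤ) : ℝ)))).length = n := by
    intro i
    have h := isSignList_pieceItin (pV i) (pH i) 0 n
    simp only [zero_add] at h
    exact h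
  refine norm_chord_integral_le hφ S u v
    (fun i => itinJac P.γ ((List.range n).map fun k =>
      (-(1 - 2 * ((pH i k % 2 : ℤ) : ℝ)), -(1 - 2 * ((pV i k % 2 : ℤ) : ℝ)))) 0 0)
    hEV0 hm hpiece hdisj hlen ?_ ?_ hpot _ ?_
  · intro i hi s hs s' hs'
    have htraj := norm_traj_sub_sub_itinJac_le P hγ hδ₀ hd hN₀ hρ hM hMδ (Nat.zero_le n) Y z hzn hz (pV i) (pH i)
      (fun t ht j h0 hj => hgood i hi t ht j h0 hj) hs hs'
    simp only [Nat.sub_zero, zero_add] at htraj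
    exact (abs_coord_sub_sub_le_of_norm_le htraj 0).trans hEVn
  · intro i _
    have h := (slopes_piece hγ0 h8 (hsl i).1).1
    rw [(hsl i).2] at h
    exact h
  · intro s hs
    rcases hcover s hs with h | ⟨j', _, hj', q, hq⟩
    · exact Or.inl h
    · exact Or.inr ⟨j', hj', q, hq⟩

end Cascade

end Summit.AnomalousDissipation.AnomalousDissipation.Theorems.SawtoothPulseCascade.K1Start
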